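import Mathlib
import HarnessLib

/-!
# Venture HSemireg — the translation-multiple criterion for the fibre-test laws (EX) and (W³)

HONEST FRAMING. Lean leaf for the computation cell `pub-hsemireg` (theory seat th-3 gen 29; file of
record `run/shared/lean/pub/pub-hsemireg/theory/TH3-SIGMA-ORBIT-PROOF.md` v1.5 §8, 2026-08-24). In
the minimal twisted-complex model of a «reduced-point complex» on a smooth threefold germ, a W-class
is given by three odd gluing operators `u₁ u₂ u₃`, three odd potentials `V₁ V₂ V₃` and three even
components `B₁ B₂ B₃` subject to the Killing relations (E1) `uₗ Vⱼ + Vⱼ uₗ = ε_{jli} Bᵢ` and the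
cocycle relation (E2) `Σₗ (uₗ Bₗ - Bₗ uₗ) = 0`; the supertrace of `X` is `trace (σ X)` for the parity
operator `σ`, which anticommutes with the odd `uₗ`. §8 of the note shows that the conjecture (W³)
(open) and the property (EX) «`B₃ ⊥ 𝔤_{u₃}`» (which holds on the cell's CAR-derived families but is
FALSE in general: note §8.12 gives an explicit 8-dimensional counterexample) are both statements
of the form «`Σₖ Zₖ ⊗ Ξₖ` is a translation multiple in `Ext²`»,
and that the translation multiples are exactly the triples
`Z₁ = P₂₃ - P₃₂ + {u₁,γ}`, `Z₂ = P₃₁ - P₁₃ + {u₂,γ}`, `Z₃ = P₁₂ - P₂₁ + {u₃,γ}` with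
divergence-free fields `Σᵢ (uᵢ Pⱼᵢ - Pⱼᵢ uᵢ) = 0` (j = 1,2,3) and an arbitrary odd `γ`.
THIS FILE kernel-checks the CRITERION LEMMA §8.3: for every such triple and every class satisfying
(E1) and (E2), `Σₖ str(Zₖ Bₖ) = 0` — for every field, every dimension, with no genericity
hypothesis: whenever the witnesses exist, the pairing vanishes. The converse (Serre duality in
the model), the machine verification of the witnesses on the cell's instances (and of their
non-existence on the counterexample), and the model itself are NOT formalised; no object is
constructed; nothing here bears on HC, HC_CM or HC_AV.
-/

namespace Summit.Ventures.HSemireg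

open LinearMap

variable {F : Type*} [Field F]
variable {U : Type*} [AddCommGroup U] [Module F U]

/-- **Odd cyclicity of the supertrace.** If the parity operator `σ` anticommutes with `u`
(`σ u = -(u σ)`, i.e. `u` is odd), then for every `Q`: `trace (σ (u Q)) = - trace (σ (Q u))`
— moving an odd operator cyclically through the supertrace costs a sign. [folklore] -/
theorem supertrace_odd_cyclic (σ u Q : Module.End F U) (hσu : σ * u = -(u * σ)) :
    LinearMap.trace F U (σ * (u * Q)) = -LinearMap.trace F U (σ * (Q * u)) := by
  have h1 : σ * (u * Q) = -(u * (σ * Q)) := by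
    rw [← mul_assoc, hσu, neg_mul, mul_assoc]
  rw [h1, map_neg, LinearMap.trace_mul_comm, mul_assoc]

/-- **Adjointness of `{u,·}` and `[·,u]` under the supertrace.** For odd `u` (`σ u = -(u σ)`),
even-or-not `P` and any `V`: `str(P {u,V}) = str([P,u] V)`, i.e.
`trace (σ (P (u V + V u))) = trace (σ ((P u - u P) V))`. (TH3-SIGMA-ORBIT-PROOF §3, §8.3.)
[folklore] -/
theorem supertrace_mul_anticomm_eq_comm_mul (σ u P V : Module.End F U) (hσu : σ * u = -(u * σ)) :
    LinearMap.trace F U (σ * (P * (u * V + V * u))) =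
      LinearMap.trace F U (σ * ((P * u - u * P) * V)) := by
  have h := supertrace_odd_cyclic σ u (P * V) hσu
  have eL : σ * (P * (u * V + V * u)) = σ * (P * u * V) + σ * ((P * V) * u) := by noncomm_ring
  have eR : σ * ((P * u - u * P) * V) = σ * (P * u * V) - σ * (u * (P * V)) := by noncomm_ring
  rw [eL, eR, map_add, map_sub, h]
  ring

/-- **The (E2)-pairing identity.** For odd `u` and any `γ, B`:
`str({u,γ} B) = str(γ [u,B])`, i.e. `trace (σ ((u γ + γ u) B)) = trace (σ (γ (u B - B u)))`.
Summed over the three directions this pairs the gradient `({uₗ,γ})ₗ` with a class `(Bₗ)ₗ` to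
`str(γ · Σₗ [uₗ,Bₗ])`, which (E2) kills. (TH3-SIGMA-ORBIT-PROOF §8.3.) [folklore] -/
theorem supertrace_anticomm_mul_eq_mul_comm (σ u γ B : Module.End F U) (hσu : σ * u = -(u * σ)) :
    LinearMap.trace F U (σ * ((u * γ + γ * u) * B)) =
      LinearMap.trace F U (σ * (γ * (u * B - B * u))) := by
  have h := supertrace_odd_cyclic σ u (γ * B) hσu
  have eL : σ * ((u * γ + γ * u) * B) = σ * (u * (γ * B)) + σ * (γ * u * B) := by noncomm_ring
  have eR : σ * (γ * (u * B - B * u)) = σ * (γ * u * B) - σ * ((γ * B) * u) := by noncomm_ring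
  rw [eL, eR, map_add, map_sub, h]
  ring

/-- **CRITERION LEMMA (TH3-SIGMA-ORBIT-PROOF v1.5 §8.3).** Let `σ` anticommute with the three odd
gluing operators `u₁ u₂ u₃`. Let `(V, B)` be a class: the nine Killing relations (E1)
`uₗ Vⱼ + Vⱼ uₗ = ε_{jli} Bᵢ` (so `{u₁,V₁} = {u₂,V₂} = {u₃,V₃} = 0`, `{u₂,V₁} = B₃ = -{u₁,V₂}`,
`{u₃,V₂} = B₁ = -{u₂,V₃}`, `{u₁,V₃} = B₂ = -{u₃,V₁}`) and the cocycle relation (E2)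
`Σₗ (uₗ Bₗ - Bₗ uₗ) = 0`. Let `Pⱼᵢ` (j,i = 1,2,3) be three divergence-free fields,
`Σᵢ (uᵢ Pⱼᵢ - Pⱼᵢ uᵢ) = 0` for each `j`, and `γ` arbitrary. Then the «translation multiple»
`Z₁ = P₂₃ - P₃₂ + {u₁,γ}`, `Z₂ = P₃₁ - P₁₃ + {u₂,γ}`, `Z₃ = P₁₂ - P₂₁ + {u₃,γ}` pairs to zero
with the class: `str(Z₁B₁) + str(Z₂B₂) + str(Z₃B₃) = 0`. In the model this is
`θ(κ · Σₖ ZₖΞₖ) = 0` for `Σₖ ZₖΞₖ ∈ Σⱼ τⱼ·Z¹ + B²`; with `Z = B′ × B″` it is the route to (W³),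
with `Z = (0,0,ζ)` the (EX) property of the note (true on the cell's CAR-derived families, false in
general, note §8.12). -/
theorem supertrace_translationMultiple_pairing_eq_zero
    (σ u₁ u₂ u₃ V₁ V₂ V₃ B₁ B₂ B₃ γ P₁₁ P₁₂ P₁₃ P₂₁ P₂₂ P₂₃ P₃₁ P₃₂ P₃₃ : Module.End F U)
    (hσ1 : σ * u₁ = -(u₁ * σ)) (hσ2 : σ * u₂ = -(u₂ * σ)) (hσ3 : σ * u₃ = -(u₃ * σ))
    (e11 : u₁ * V₁ + V₁ * u₁ = 0) (e22 : u₂ * V₂ + V₂ * u₂ = 0) (e33 : u₃ * V₃ + V₃ * u₃ = 0)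
    (e21 : u₂ * V₁ + V₁ * u₂ = B₃) (e12 : u₁ * V₂ + V₂ * u₁ = -B₃)
    (e32 : u₃ * V₂ + V₂ * u₃ = B₁) (e23 : u₂ * V₃ + V₃ * u₂ = -B₁)
    (e13 : u₁ * V₃ + V₃ * u₁ = B₂) (e31 : u₃ * V₁ + V₁ * u₃ = -B₂)
    (e2 : (u₁ * B₁ - B₁ * u₁) + (u₂ * B₂ - B₂ * u₂) + (u₃ * B₃ - B₃ * u₃) = 0)
    (c1 : (u₁ * P₁₁ - P₁₁ * u₁) + (u₂ * P₁₂ - P₁₂ * u₂) + (u₃ * P₁₃ - P₁₃ * u₃) = 0)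
    (c2 : (u₁ * P₂₁ - P₂₁ * u₁) + (u₂ * P₂₂ - P₂₂ * u₂) + (u₃ * P₂₃ - P₂₃ * u₃) = 0)
    (c3 : (u₁ * P₃₁ - P₃₁ * u₁) + (u₂ * P₃₂ - P₃₂ * u₂) + (u₃ * P₃₃ - P₃₃ * u₃) = 0) :
    LinearMap.trace F U (σ * ((P₂₃ - P₃₂ + (u₁ * γ + γ * u₁)) * B₁)) +
      LinearMap.trace F U (σ * ((P₃₁ - P₁₃ + (u₂ * γ + γ * u₂)) * B₂)) +
      LinearMap.trace F U (σ * ((P₁₂ - P₂₁ + (u₃ * γ + γ * u₃)) * B₃)) = 0 := by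
  -- the gradient part: pairs to str(γ · Σ[uₗ,Bₗ]) = 0 by (E2)
  have gγ : LinearMap.trace F U (σ * ((u₁ * γ + γ * u₁) * B₁)) +
      LinearMap.trace F U (σ * ((u₂ * γ + γ * u₂) * B₂)) +
      LinearMap.trace F U (σ * ((u₃ * γ + γ * u₃) * B₃)) = 0 := by
    rw [supertrace_anticomm_mul_eq_mul_comm σ u₁ γ B₁ hσ1,
      supertrace_anticomm_mul_eq_mul_comm σ u₂ γ B₂ hσ2,
      supertrace_anticomm_mul_eq_mul_comm σ u₃ γ B₃ hσ3, ← map_add, ← map_add]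
    have e : σ * (γ * (u₁ * B₁ - B₁ * u₁)) + σ * (γ * (u₂ * B₂ - B₂ * u₂)) +
        σ * (γ * (u₃ * B₃ - B₃ * u₃)) =
        σ * (γ * ((u₁ * B₁ - B₁ * u₁) + (u₂ * B₂ - B₂ * u₂) + (u₃ * B₃ - B₃ * u₃))) := by
      noncomm_ring
    rw [e, e2, mul_zero, mul_zero, map_zero]
  -- the curl part, direction j = 1: uses c1 and {u₁,V₁} = 0
  have g1 : LinearMap.trace F U (σ * (P₁₂ * B₃)) - LinearMap.trace F U (σ * (P₁₃ * B₂)) = 0 := by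
    have hB2 : B₂ = -(u₃ * V₁ + V₁ * u₃) := by rw [e31, neg_neg]
    rw [← e21, hB2, mul_neg, mul_neg, map_neg, sub_neg_eq_add,
      supertrace_mul_anticomm_eq_comm_mul σ u₂ P₁₂ V₁ hσ2,
      supertrace_mul_anticomm_eq_comm_mul σ u₃ P₁₃ V₁ hσ3, ← map_add, ← mul_add, ← add_mul]
    have hS0 : (P₁₂ * u₂ - u₂ * P₁₂) + (P₁₃ * u₃ - u₃ * P₁₃) + (P₁₁ * u₁ - u₁ * P₁₁) =
        -((u₁ * P₁₁ - P₁₁ * u₁) + (u₂ * P₁₂ - P₁₂ * u₂) + (u₃ * P₁₃ - P₁₃ * u₃)) := by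
      noncomm_ring
    rw [c1, neg_zero] at hS0
    have hS : (P₁₂ * u₂ - u₂ * P₁₂) + (P₁₃ * u₃ - u₃ * P₁₃) = -(P₁₁ * u₁ - u₁ * P₁₁) :=
      eq_neg_of_add_eq_zero_left hS0
    rw [hS, neg_mul, mul_neg, map_neg, neg_eq_zero,
      ← supertrace_mul_anticomm_eq_comm_mul σ u₁ P₁₁ V₁ hσ1, e11, mul_zero, mul_zero, map_zero]
  -- direction j = 2: uses c2 and {u₂,V₂} = 0
  have g2 : LinearMap.trace F U (σ * (P₂₃ * B₁)) - LinearMap.trace F U (σ * (P₂₁ * B₃)) = 0 := by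
    have hB3 : B₃ = -(u₁ * V₂ + V₂ * u₁) := by rw [e12, neg_neg]
    rw [← e32, hB3, mul_neg, mul_neg, map_neg, sub_neg_eq_add,
      supertrace_mul_anticomm_eq_comm_mul σ u₃ P₂₃ V₂ hσ3,
      supertrace_mul_anticomm_eq_comm_mul σ u₁ P₂₁ V₂ hσ1, ← map_add, ← mul_add, ← add_mul]
    have hS0 : (P₂₃ * u₃ - u₃ * P₂₃) + (P₂₁ * u₁ - u₁ * P₂₁) + (P₂₂ * u₂ - u₂ * P₂₂) =
        -((u₁ * P₂₁ - P₂₁ * u₁) + (u₂ * P₂₂ - P₂₂ * u₂) + (u₃ * P₂₃ - P₂₃ * u₃)) := by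
      noncomm_ring
    rw [c2, neg_zero] at hS0
    have hS : (P₂₃ * u₃ - u₃ * P₂₃) + (P₂₁ * u₁ - u₁ * P₂₁) = -(P₂₂ * u₂ - u₂ * P₂₂) :=
      eq_neg_of_add_eq_zero_left hS0
    rw [hS, neg_mul, mul_neg, map_neg, neg_eq_zero,
      ← supertrace_mul_anticomm_eq_comm_mul σ u₂ P₂₂ V₂ hσ2, e22, mul_zero, mul_zero, map_zero]
  -- direction j = 3: uses c3 and {u₃,V₃} = 0
  have g3 : LinearMap.trace F U (σ * (P₃₁ * B₂)) - LinearMap.trace F U (σ * (P₃₂ * B₁)) = 0 := by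
    have hB1 : B₁ = -(u₂ * V₃ + V₃ * u₂) := by rw [e23, neg_neg]
    rw [← e13, hB1, mul_neg, mul_neg, map_neg, sub_neg_eq_add,
      supertrace_mul_anticomm_eq_comm_mul σ u₁ P₃₁ V₃ hσ1,
      supertrace_mul_anticomm_eq_comm_mul σ u₂ P₃₂ V₃ hσ2, ← map_add, ← mul_add, ← add_mul]
    have hS0 : (P₃₁ * u₁ - u₁ * P₃₁) + (P₃₂ * u₂ - u₂ * P₃₂) + (P₃₃ * u₃ - u₃ * P₃₃) =
        -((u₁ * P₃₁ - P₃₁ * u₁) + (u₂ * P₃₂ - P₃₂ * u₂) + (u₃ * P₃₃ - P₃₃ * u₃)) := by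
      noncomm_ring
    rw [c3, neg_zero] at hS0
    have hS : (P₃₁ * u₁ - u₁ * P₃₁) + (P₃₂ * u₂ - u₂ * P₃₂) = -(P₃₃ * u₃ - u₃ * P₃₃) :=
      eq_neg_of_add_eq_zero_left hS0
    rw [hS, neg_mul, mul_neg, map_neg, neg_eq_zero,
      ← supertrace_mul_anticomm_eq_comm_mul σ u₃ P₃₃ V₃ hσ3, e33, mul_zero, mul_zero, map_zero]
  -- assemble
  have x1 : σ * ((P₂₃ - P₃₂ + (u₁ * γ + γ * u₁)) * B₁) =
      σ * (P₂₃ * B₁) - σ * (P₃₂ * B₁) + σ * ((u₁ * γ + γ * u₁) * B₁) := by noncomm_ring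
  have x2 : σ * ((P₃₁ - P₁₃ + (u₂ * γ + γ * u₂)) * B₂) =
      σ * (P₃₁ * B₂) - σ * (P₁₃ * B₂) + σ * ((u₂ * γ + γ * u₂) * B₂) := by noncomm_ring
  have x3 : σ * ((P₁₂ - P₂₁ + (u₃ * γ + γ * u₃)) * B₃) =
      σ * (P₁₂ * B₃) - σ * (P₂₁ * B₃) + σ * ((u₃ * γ + γ * u₃) * B₃) := by noncomm_ring
  rw [x1, x2, x3]
  simp only [map_add, map_sub]
  linear_combination gγ + g1 + g2 + g3

/-- **The (EX) form of the criterion (TH3-SIGMA-ORBIT-PROOF v1.5 §8.2 (U)).** Same data as in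
`supertrace_translationMultiple_pairing_eq_zero`. If the witnesses make the first two components
of the translation multiple vanish and the third equal to `ζ` — `P₂₃ - P₃₂ + {u₁,γ} = 0`,
`P₃₁ - P₁₃ + {u₂,γ} = 0`, `P₁₂ - P₂₁ + {u₃,γ} = ζ` — then `str(ζ B₃) = 0` for the class. This is
how the pure-`u` statement (U) of the note implies the property (EX) «`B₃ ⊥ 𝔤_{u₃}`» where the
witnesses exist (they do on the cell's CAR-derived instances, by exact linear algebra; they do not
on the counterexample module of note §8.12, where (EX) fails). -/
theorem supertrace_stabilizer_mul_B3_eq_zero_of_witness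
    (σ u₁ u₂ u₃ V₁ V₂ V₃ B₁ B₂ B₃ γ ζ P₁₁ P₁₂ P₁₃ P₂₁ P₂₂ P₂₃ P₃₁ P₃₂ P₃₃ : Module.End F U)
    (hσ1 : σ * u₁ = -(u₁ * σ)) (hσ2 : σ * u₂ = -(u₂ * σ)) (hσ3 : σ * u₃ = -(u₃ * σ))
    (e11 : u₁ * V₁ + V₁ * u₁ = 0) (e22 : u₂ * V₂ + V₂ * u₂ = 0) (e33 : u₃ * V₃ + V₃ * u₃ = 0)
    (e21 : u₂ * V₁ + V₁ * u₂ = B₃) (e12 : u₁ * V₂ + V₂ * u₁ = -B₃)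
    (e32 : u₃ * V₂ + V₂ * u₃ = B₁) (e23 : u₂ * V₃ + V₃ * u₂ = -B₁)
    (e13 : u₁ * V₃ + V₃ * u₁ = B₂) (e31 : u₃ * V₁ + V₁ * u₃ = -B₂)
    (e2 : (u₁ * B₁ - B₁ * u₁) + (u₂ * B₂ - B₂ * u₂) + (u₃ * B₃ - B₃ * u₃) = 0)
    (c1 : (u₁ * P₁₁ - P₁₁ * u₁) + (u₂ * P₁₂ - P₁₂ * u₂) + (u₃ * P₁₃ - P₁₃ * u₃) = 0)
    (c2 : (u₁ * P₂₁ - P₂₁ * u₁) + (u₂ * P₂₂ - P₂₂ * u₂) + (u₃ * P₂₃ - P₂₃ * u₃) = 0)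
    (c3 : (u₁ * P₃₁ - P₃₁ * u₁) + (u₂ * P₃₂ - P₃₂ * u₂) + (u₃ * P₃₃ - P₃₃ * u₃) = 0)
    (w1 : P₂₃ - P₃₂ + (u₁ * γ + γ * u₁) = 0) (w2 : P₃₁ - P₁₃ + (u₂ * γ + γ * u₂) = 0)
    (w3 : P₁₂ - P₂₁ + (u₃ * γ + γ * u₃) = ζ) :
    LinearMap.trace F U (σ * (ζ * B₃)) = 0 := by
  have h := supertrace_translationMultiple_pairing_eq_zero σ u₁ u₂ u₃ V₁ V₂ V₃ B₁ B₂ B₃ γ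
    P₁₁ P₁₂ P₁₃ P₂₁ P₂₂ P₂₃ P₃₁ P₃₂ P₃₃ hσ1 hσ2 hσ3 e11 e22 e33 e21 e12 e32 e23 e13 e31 e2 c1 c2 c3
  rw [w1, w2, w3] at h
  simpa only [zero_mul, mul_zero, map_zero, zero_add] using h

end Summit.Ventures.HSemireg
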